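import Literature.Topology.FourManifolds.TautFoliationsCollarImagePaths
import Literature.Topology.FourManifolds.TautFoliationsPartitionIndex
import Literature.Topology.FourManifolds.TautFoliationsPlaqueHomotopy
import Literature.Topology.FourManifolds.TautFoliationsNullTransportM
import HarnessLib

/-!
# The image of the contour leaf of the coned collar is homotopic to the lift of the loop

Topic: the coned fence collar, plan (d) F4 (core). Data: a cone position `P` of the collar disc
`G` keeping `G` on the outer-collar edges, a generic radius `R`, an increasing enumeration
`0 = θ₀ < ⋯ < θ_N = 1` of the crossing parameters of the ring `ringParam c₀ R` with the
1-skeleton, and closed squares `Q_j ⊇ ringParam [θ_j, θ_{j+1}]`. We construct a loop `δ` in the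
plane running, on `[θ_j, θ_{j+1}]`, along the contour arc `ringLevel Q_j R` from the crossing
point `p_j` to `p_{j+1}` (paths exist as the arcs are path connected), and the **plaque-wise
straight-line homotopy** between the horizontal loop of the fence at the level of `R` — which is
`θ ↦ G (ringParam θ)` exactly — and the loop `θ ↦ fill (δ θ)`: on `[θ_j, θ_{j+1}]` both run in
the plaque of the box of `Q_j` at the radial level, and they agree at the crossing points, where
`fill = G`. Pasting over the finitely many pieces (`PartitionIndex`) gives a homotopy of loops in
the leaf space (`exists_fillLoop_homotopic`). Consequently, if the level of `R` is not a null
level of the fence, the loop `fill ∘ δ` of the compact contour leaf is essential (sequel).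

* `Foliation.ConePosition.exists_fillLoop_homotopic` (**proved**).

All statements are [folklore].
-/

noncomputable section

open Set Filter Metric Topology Function Real
open scoped unitInterval
open Literature.Topology.PlanarFoliations

namespace Literature.Topology.FourManifolds

namespace Foliation.ConePosition

open SquareGrid SquareGrid.Grid SquarePolar ConeSquare CollarRadius Partition

variable {B : Type*} [NormedAddCommGroup B] [NormedSpace ℝ B] {M : Type*} [TopologicalSpace M] {F : Foliation B M}
variable {Γ : C(I, F.GermSpace)} {τ₀ ε : ℝ} {Φ : I → ℝ → M} {c₀ : ℝ × ℝ} {L : ℝ} {hL : 0 < L} {G : ℝ × ℝ → M}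
variable (P : ConePosition F G c₀ hL)

variable (hΦ : IsFenceOn F Γ τ₀ ε Φ univ) (hcl : ∀ τ ∈ Ioo (τ₀ - ε) (τ₀ + ε), Φ 1 τ = Φ 0 τ) {τ₁ : ℝ}
  (hτI : uIcc τ₀ τ₁ ⊆ Ioo (τ₀ - ε) (τ₀ + ε)) (h01 : τ₁ ≠ τ₀)
  (hG : ∀ x, L / 2 ≤ dist x c₀ → G x = Φ (angleParam c₀ x) (levelOfParam τ₀ τ₁ (1 - dist x c₀ / L)))
  (hGc : Continuous G) (hn32 : 32 ≤ P.n)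
  (hskelT : ∀ q k, P.gr.edge q k '' Icc 0 (2 * P.gr.ℓ) ⊆ {x | 7 * L / 8 ≤ dist x c₀} →
    ∀ s ∈ Icc 0 (2 * P.gr.ℓ), P.skel (P.gr.edge q k s) = G (P.gr.edge q k s))
  {R : ℝ} (hR : 15 * L / 16 ≤ R)

include hΦ hcl hτI h01 hG hGc hn32 hskelT hR in
/-- **The horizontal loop of the fence at the level of `R` is homotopic, in the leaf space, to
the filled image of a loop running along the contour arcs of the ring squares.** [folklore] -/
theorem exists_fillLoop_homotopic (ho : F.IsTransverselyOriented) (hRL : R + 2 * P.gr.ℓ < L)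
    {N : ℕ} (hN : 0 < N) {θs : Fin (N + 1) → ℝ} (hmono : StrictMono θs) (h0 : θs 0 = 0) (hlast : θs (Fin.last N) = 1)
    (hskel : ∀ j, ringParam c₀ R (θs j) ∈ P.gr.skeleton) {Qs : Fin N → Fin P.n × Fin P.n}
    (hQs : ∀ j : Fin N, ringParam c₀ R '' piece θs j ⊆ P.gr.sq (Qs j)) {τR : ℝ} (hτRdef : τR = levelOfParam τ₀ τ₁ (1 - R / L)) :
    ∃ (hτR : τR ∈ Ioo (τ₀ - ε) (τ₀ + ε)) (hclR : Φ 1 τR = Φ 0 τR) (δ : ℝ → ℝ × ℝ)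
      (ℓ₂ : Path (toLeafSpace (Φ 0 τR) : F.LeafSpace) (toLeafSpace (Φ 0 τR))),
      ContinuousOn δ (Icc 0 1) ∧ (∀ θ, ∃ j, δ θ ∈ P.ringLevel (Qs j) R) ∧ δ 0 = ringParam c₀ R 0 ∧ δ 1 = ringParam c₀ R 0 ∧
      (∀ θ : I, ℓ₂ θ = toLeafSpace (P.fill P.apex (δ θ))) ∧ (hΦ.horizLoop τR hτR hclR).Homotopic ℓ₂ := by
  classical
  have hL' : 0 < L := hL
  have hℓ := P.gr.hℓ
  have hR0 : 0 < R := by linarith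
  have hRL2 : L / 2 ≤ R := by linarith
  have hτR : τR ∈ Ioo (τ₀ - ε) (τ₀ + ε) := by rw [hτRdef]; exact hτI (levelOfParam_mem _ _ _)
  have hclR : Φ 1 τR = Φ 0 τR := hcl _ hτR
  /- 1. the horizontal loop read along the ring -/
  set L₁ : ℝ → M := fun θ ↦ Φ (projIcc 0 1 zero_le_one θ) τR with hL₁
  have hL₁c : Continuous L₁ := by
    have hc : Continuous fun a : I ↦ Φ a τR :=
      continuousOn_univ.1 (hΦ.cont.comp (continuous_id.prodMk continuous_const).continuousOn fun a _ ↦ ⟨mem_univ a, hτR⟩)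
    exact hc.comp continuous_projIcc
  have hL₁G : ∀ θ ∈ Icc (0 : ℝ) 1, G (ringParam c₀ R θ) = L₁ θ := by
    intro θ hθ
    rcases hθ.2.lt_or_eq with hlt | heq
    · rw [apply_ringParam hG hR0 hRL2 ⟨hθ.1, hlt⟩, ← hτRdef]
      show Φ _ τR = Φ (projIcc 0 1 zero_le_one θ) τR
      congr 1; exact Subtype.ext (by rw [projIcc_of_mem _ hθ])
    · subst heq
      rw [ringParam_one, apply_ringParam hG hR0 hRL2 ⟨le_rfl, zero_lt_one⟩, ← hτRdef]
      show Φ _ τR = Φ (projIcc 0 1 zero_le_one 1) τR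
      rw [projIcc_right]
      calc Φ _ τR = Φ 0 τR := congrArg (Φ · τR) (Subtype.ext rfl)
        _ = Φ 1 τR := hclR.symm
        _ = Φ _ τR := congrArg (Φ · τR) (Subtype.ext rfl)
  /- 2. the pieces, the squares, the crossing points -/
  have hlt : ∀ j : Fin N, θs (Fin.castSucc j) < θs j.succ := fun j ↦ hmono (Fin.castSucc_lt_succ (i := j))
  have hpiece01 : ∀ j : Fin N, piece θs j ⊆ Icc (0 : ℝ) 1 := fun j θ hθ ↦
    ⟨h0.symm.le.trans ((hmono.monotone (Fin.zero_le _)).trans hθ.1),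
      (hθ.2.trans (hmono.monotone (Fin.le_last _))).trans hlast.le⟩
  have hθs01 : ∀ i : Fin (N + 1), θs i ∈ Icc (0 : ℝ) 1 := fun i ↦
    ⟨h0.symm.le.trans (hmono.monotone (Fin.zero_le _)), (hmono.monotone (Fin.le_last _)).trans hlast.le⟩
  have hsqθ : ∀ j : Fin N, ∀ θ ∈ piece θs j, ringParam c₀ R θ ∈ P.gr.sq (Qs j) := fun j θ hθ ↦ hQs j ⟨θ, hθ, rfl⟩
  have hLmem : ∀ j : Fin N, θs (Fin.castSucc j) ∈ piece θs j := fun j ↦ ⟨le_rfl, (hlt j).le⟩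
  have hRmem : ∀ j : Fin N, θs j.succ ∈ piece θs j := fun j ↦ ⟨(hlt j).le, le_rfl⟩
  have hQR : ∀ j : Fin N, (P.gr.sq (Qs j) ∩ sphere c₀ R).Nonempty := fun j ↦
    ⟨_, hsqθ j _ (hLmem j), mem_sphere.2 (dist_ringParam hR0.le _)⟩
  -- crossing points are on the spheres of their squares, hence on the contour arcs, where `fill = G`
  have hsph : ∀ j : Fin N, ∀ i : Fin (N + 1), θs i ∈ piece θs j → ringParam c₀ R (θs i) ∈ sphere (P.gr.centre (Qs j)) P.gr.ℓ :=
    fun j i hi ↦ P.mem_sphere_of_mem_skeleton_of_mem_sq (hskel i) (hsqθ j _ hi)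
  have hlev : ∀ j : Fin N, ∀ i : Fin (N + 1), θs i ∈ piece θs j → ringParam c₀ R (θs i) ∈ P.ringLevel (Qs j) R :=
    fun j i hi ↦ P.mem_ringLevel_of_mem_sphere hΦ hcl hτI h01 hG hGc hn32 hskelT hR ho (hsph j i hi) (dist_ringParam hR0.le _)
  have hfillG : ∀ j : Fin N, ∀ i : Fin (N + 1), θs i ∈ piece θs j → P.fill P.apex (ringParam c₀ R (θs i)) = L₁ (θs i) :=
    fun j i hi ↦ by rw [P.fill_eq_apply_of_mem_sphere hn32 hskelT hR (hQR j) (hsph j i hi), hL₁G _ (hθs01 i)]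
  /- 3. paths along the contour arcs and the loop `δ` -/
  choose e he using fun j : Fin N ↦ P.exists_path_ringLevel hΦ hcl hτI h01 hG hGc hn32 hskelT hR (hQR j)
    (hlev j (Fin.castSucc j) (hLmem j)) (hlev j j.succ (hRmem j))
  set g : Fin N → ℝ → ℝ × ℝ := fun j θ ↦ e j (projIcc 0 1 zero_le_one (rescale θs j θ)) with hg
  have hgc : ∀ j, Continuous (g j) := fun j ↦ (e j).continuous.comp (continuous_projIcc.comp (continuous_rescale j))
  have hg_mem : ∀ j θ, g j θ ∈ P.ringLevel (Qs j) R := fun j θ ↦ he j _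
  have hg_left : ∀ j, g j (θs (Fin.castSucc j)) = ringParam c₀ R (θs (Fin.castSucc j)) := fun j ↦ by
    show e j (projIcc 0 1 zero_le_one (rescale θs j (θs (Fin.castSucc j)))) = _
    rw [rescale_left, projIcc_left]; exact (e j).source
  have hg_right : ∀ j, g j (θs j.succ) = ringParam c₀ R (θs j.succ) := fun j ↦ by
    show e j (projIcc 0 1 zero_le_one (rescale θs j (θs j.succ))) = _
    rw [rescale_right hmono, projIcc_right]; exact (e j).target
  -- the piece index of a parameter
  set jOf : ℝ → Fin N := fun θ ↦ if h : ∃ j, θ ∈ piece θs j then h.choose else ⟨0, hN⟩ with hjOfdef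
  have hjOf : ∀ θ ∈ Icc (0 : ℝ) 1, θ ∈ piece θs (jOf θ) := fun θ hθ ↦ by
    have hex : ∃ j, θ ∈ piece θs j := exists_piece hmono hN (by rw [h0, hlast]; exact hθ)
    have : jOf θ = hex.choose := dif_pos hex
    rw [this]; exact hex.choose_spec
  set δ : ℝ → ℝ × ℝ := fun θ ↦ g (jOf θ) θ with hδ
  -- two pieces containing `θ` give the same value
  have hgg : ∀ {j j' : Fin N} {θ : ℝ}, θ ∈ piece θs j → θ ∈ piece θs j' → g j θ = g j' θ := by
    intro j j' θ hj hj'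
    rcases lt_trichotomy j j' with hjj | rfl | hjj
    · obtain ⟨h1, h2⟩ := mem_piece_mem_piece hmono hjj hj hj'
      calc g j θ = g j (θs j.succ) := by rw [← h1]
        _ = ringParam c₀ R (θs j.succ) := hg_right j
        _ = ringParam c₀ R (θs (Fin.castSucc j')) := by rw [← h1, ← h2]
        _ = g j' (θs (Fin.castSucc j')) := (hg_left j').symm
        _ = g j' θ := by rw [← h2]
    · rfl
    · obtain ⟨h1, h2⟩ := mem_piece_mem_piece hmono hjj hj' hj
      calc g j θ = g j (θs (Fin.castSucc j)) := by rw [← h2]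
        _ = ringParam c₀ R (θs (Fin.castSucc j)) := hg_left j
        _ = ringParam c₀ R (θs j'.succ) := by rw [← h2, ← h1]
        _ = g j' (θs j'.succ) := (hg_right j').symm
        _ = g j' θ := by rw [← h1]
  have hagree : ∀ j, ∀ θ ∈ piece θs j, δ θ = g j θ := fun j θ hθ ↦ hgg (hjOf θ (hpiece01 j hθ)) hθ
  have hδc : ContinuousOn δ (Icc 0 1) := by
    have h := continuousOn_of_pieces hmono hN (f := δ) fun j ↦ ⟨g j, (hgc j).continuousOn, hagree j⟩
    rwa [h0, hlast] at h
  have hδmem : ∀ θ, δ θ ∈ P.ringLevel (Qs (jOf θ)) R := fun θ ↦ hg_mem _ _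
  -- values at the partition points
  have hδpart : ∀ i : Fin (N + 1), δ (θs i) = ringParam c₀ R (θs i) := by
    intro i
    set j := jOf (θs i) with hj
    have hmem : θs i ∈ piece θs j := hjOf _ (hθs01 i)
    have h1 : (Fin.castSucc j : Fin (N + 1)) ≤ i := hmono.le_iff_le.1 hmem.1
    have h2 : i ≤ j.succ := hmono.le_iff_le.1 hmem.2
    have h1' : (j : ℕ) ≤ (i : ℕ) := h1
    have h2' : (i : ℕ) ≤ (j : ℕ) + 1 := h2
    show g j (θs i) = _
    rcases Nat.eq_or_lt_of_le h1' with h | h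
    · have hi : i = Fin.castSucc j := Fin.ext h.symm
      rw [hi]; exact hg_left j
    · have hi : i = j.succ := Fin.ext (by simp; omega)
      rw [hi]; exact hg_right j
  have hδ0 : δ 0 = ringParam c₀ R 0 := by have h := hδpart 0; rwa [h0] at h
  have hδ1 : δ 1 = ringParam c₀ R 0 := by
    have h := hδpart (Fin.last N); rw [hlast] at h; rw [h, ringParam_one]
  /- 4. plaque memberships -/
  have hpl₁ : ∀ j : Fin N, ∀ θ ∈ piece θs j, L₁ θ ∈ plaque (P.box (Qs j)) (P.radialHt (Qs j) R) := fun j θ hθ ↦ by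
    rw [← hL₁G θ (hpiece01 j hθ)]
    exact P.apply_mem_plaque_of_dist_eq hΦ hcl hτI hG hn32 hR (hQR j) (hsqθ j θ hθ) (dist_ringParam hR0.le θ)
  have hpl₂ : ∀ (j : Fin N) θ, P.fill P.apex (g j θ) ∈ plaque (P.box (Qs j)) (P.radialHt (Qs j) R) := fun j θ ↦
    P.fill_mem_plaque_of_mem_ringLevel (hg_mem j θ)
  -- at a parameter in two pieces, both maps pass through the same point
  have hcoin : ∀ {j j' : Fin N} {θ : ℝ}, j ≠ j' → θ ∈ piece θs j → θ ∈ piece θs j' → L₁ θ = P.fill P.apex (g j θ) := by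
    intro j j' θ hne hj hj'
    rcases lt_or_gt_of_ne hne with hjj | hjj
    · obtain ⟨h1, -⟩ := mem_piece_mem_piece hmono hjj hj hj'
      rw [h1, hg_right j, hfillG j j.succ (hRmem j)]
    · obtain ⟨-, h2⟩ := mem_piece_mem_piece hmono hjj hj' hj
      rw [h2, hg_left j, hfillG j (Fin.castSucc j) (hLmem j)]
  /- 5. the homotopy, piece by piece -/
  set Hf : ℝ × ℝ → F.LeafSpace := fun x ↦
    F.plaqueInterp (P.box (Qs (jOf x.2))) (P.radialHt (Qs (jOf x.2)) R) (L₁ x.2) (P.fill P.apex (δ x.2)) x.1 with hHf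
  set hf : Fin N → ℝ × ℝ → F.LeafSpace := fun j x ↦
    F.plaqueInterp (P.box (Qs j)) (P.radialHt (Qs j) R) (L₁ x.2) (P.fill P.apex (g j x.2)) x.1 with hhf
  have hS : P.gr.S = closedBall c₀ L := grid_S hL P.hn
  have hfillc : ∀ j, Continuous fun θ ↦ P.fill P.apex (g j θ) := fun j ↦
    P.continuousOn_fill.comp_continuous (hgc j) fun θ ↦ by rw [← hS]; exact P.gr.sq_subset_S _ (hg_mem j θ).1
  have hhfc : ∀ j, ContinuousOn (hf j) ((univ : Set ℝ) ×ˢ piece θs j) := by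
    intro j
    rw [continuousOn_iff_continuous_restrict]
    have hval : Continuous fun y : ↥((univ : Set ℝ) ×ˢ piece θs j) ↦ (y : ℝ × ℝ) := continuous_subtype_val
    have hf₁ : Continuous fun y : ↥((univ : Set ℝ) ×ˢ piece θs j) ↦ L₁ (y : ℝ × ℝ).2 := hL₁c.comp (continuous_snd.comp hval)
    have hf₂ : Continuous fun y : ↥((univ : Set ℝ) ×ˢ piece θs j) ↦ P.fill P.apex (g j (y : ℝ × ℝ).2) :=
      (hfillc j).comp (continuous_snd.comp hval)
    have hf₃ : Continuous fun y : ↥((univ : Set ℝ) ×ˢ piece θs j) ↦ (y : ℝ × ℝ).1 := continuous_fst.comp hval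
    have hs₁ : ∀ y : ↥((univ : Set ℝ) ×ˢ piece θs j), L₁ (y : ℝ × ℝ).2 ∈ (P.box (Qs j)).source := fun y ↦ (hpl₁ j (y : ℝ × ℝ).2 y.2.2).1
    have hs₂ : ∀ y : ↥((univ : Set ℝ) ×ˢ piece θs j), P.fill P.apex (g j (y : ℝ × ℝ).2) ∈ (P.box (Qs j)).source := fun y ↦ (hpl₂ j (y : ℝ × ℝ).2).1
    have hc : Continuous fun y : ↥((univ : Set ℝ) ×ˢ piece θs j) ↦
        F.plaqueInterp (P.box (Qs j)) (P.radialHt (Qs j) R) (L₁ (y : ℝ × ℝ).2) (P.fill P.apex (g j (y : ℝ × ℝ).2)) (y : ℝ × ℝ).1 :=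
      F.continuous_plaqueInterp (P.box_mem (Qs j)) hf₁ hf₂ hf₃ hs₁ hs₂
    exact hc
  have hHagree : ∀ j, ∀ x ∈ (univ : Set ℝ) ×ˢ piece θs j, Hf x = hf j x := by
    rintro j ⟨sg, θ⟩ ⟨-, hθ⟩
    have hθ' := hjOf θ (hpiece01 j hθ)
    by_cases hjj : jOf θ = j
    · show F.plaqueInterp (P.box (Qs (jOf θ))) (P.radialHt (Qs (jOf θ)) R) (L₁ θ) (P.fill P.apex (g (jOf θ) θ)) sg =
        F.plaqueInterp (P.box (Qs j)) (P.radialHt (Qs j) R) (L₁ θ) (P.fill P.apex (g j θ)) sg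
      rw [hjj]
    · -- a common end point: both interpolations are constant
      have h1 : L₁ θ = P.fill P.apex (g (jOf θ) θ) := hcoin hjj hθ' hθ
      have h2 : L₁ θ = P.fill P.apex (g j θ) := by rw [h1]; exact congrArg _ (hgg hθ' hθ)
      show F.plaqueInterp (P.box (Qs (jOf θ))) (P.radialHt (Qs (jOf θ)) R) (L₁ θ) (P.fill P.apex (g (jOf θ) θ)) sg =
        F.plaqueInterp (P.box (Qs j)) (P.radialHt (Qs j) R) (L₁ θ) (P.fill P.apex (g j θ)) sg
      rw [← h1, F.plaqueInterp_self (hpl₁ _ θ hθ') sg, ← h2, F.plaqueInterp_self (hpl₁ j θ hθ) sg]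
  have hHc : ContinuousOn Hf ((univ : Set ℝ) ×ˢ Icc 0 1) := by
    have h := continuousOn_prod_of_pieces hmono hN isClosed_univ (f := Hf) fun j ↦ ⟨hf j, hhfc j, hHagree j⟩
    rwa [h0, hlast] at h
  have hHcI : Continuous fun x : I × I ↦ Hf ((x.1 : ℝ), (x.2 : ℝ)) :=
    hHc.comp_continuous ((continuous_subtype_val.comp continuous_fst).prodMk (continuous_subtype_val.comp continuous_snd))
      fun x ↦ ⟨mem_univ _, x.2.2⟩
  -- values on the bottom, the top and the sides
  have hbot : ∀ θ : I, Hf (0, θ) = toLeafSpace (L₁ θ) := fun θ ↦ F.plaqueInterp_zero (hpl₁ _ _ (hjOf θ θ.2))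
  have htop : ∀ θ : I, Hf (1, θ) = toLeafSpace (P.fill P.apex (δ θ)) := fun θ ↦ F.plaqueInterp_one (hpl₂ _ _)
  have hL₁θ : ∀ θ : I, L₁ θ = Φ θ τR := fun θ ↦ by
    show Φ (projIcc 0 1 zero_le_one (θ : ℝ)) τR = Φ θ τR
    rw [projIcc_val]
  have hside : ∀ sg : ℝ, ∀ θ : I, (θ : ℝ) = 0 ∨ (θ : ℝ) = 1 → Hf (sg, θ) = toLeafSpace (L₁ θ) := by
    intro sg θ hθ
    have hpt : ∃ i : Fin (N + 1), (θ : ℝ) = θs i := by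
      rcases hθ with h | h
      · exact ⟨0, by rw [h, h0]⟩
      · exact ⟨Fin.last N, by rw [h, hlast]⟩
    obtain ⟨i, hi⟩ := hpt
    have hmem := hjOf θ θ.2
    have heq : L₁ θ = P.fill P.apex (δ θ) := by
      rw [hi, hδpart i, hfillG (jOf (θs i)) i (hi ▸ hmem)]
    show F.plaqueInterp _ _ (L₁ θ) (P.fill P.apex (δ θ)) sg = _
    rw [← heq, F.plaqueInterp_self (hpl₁ _ _ hmem) sg]
  -- the second loop
  have hq₀ : toLeafSpace (L₁ (0 : I)) = (toLeafSpace (Φ 0 τR) : F.LeafSpace) := by rw [hL₁θ]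
  refine ⟨hτR, hclR, δ,
    { toFun := fun θ ↦ Hf (1, θ)
      continuous_toFun := by exact hHcI.comp ((continuous_const (y := (1 : I))).prodMk continuous_id)
      source' := ?_
      target' := ?_ }, hδc, fun θ ↦ ⟨_, hδmem θ⟩, hδ0, hδ1, fun θ ↦ htop θ, ?_⟩
  · show Hf (1, (0 : I)) = toLeafSpace (Φ 0 τR)
    rw [hside 1 0 (Or.inl rfl), hL₁θ]
  · show Hf (1, (1 : I)) = toLeafSpace (Φ 0 τR)
    rw [hside 1 1 (Or.inr rfl), hL₁θ, ← hclR]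
  · refine ⟨{ toFun := fun x ↦ Hf ((x.1 : ℝ), (x.2 : ℝ))
              continuous_toFun := hHcI
              map_zero_left := fun θ ↦ ?_
              map_one_left := fun θ ↦ ?_
              prop' := fun sg θ hθ ↦ ?_ }⟩
    · show Hf (((0 : I) : ℝ), (θ : ℝ)) = hΦ.horizLoop τR hτR hclR θ
      rw [IsFenceOn.horizLoop_apply, ← hL₁θ]; exact hbot θ
    · rfl
    · show Hf ((sg : ℝ), (θ : ℝ)) = hΦ.horizLoop τR hτR hclR θ
      rw [IsFenceOn.horizLoop_apply, ← hL₁θ]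
      refine hside sg θ ?_
      rcases hθ with h | h
      · exact Or.inl (by rw [h]; rfl)
      · exact Or.inr (by rw [h]; rfl)

end Foliation.ConePosition

end Literature.Topology.FourManifolds
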